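import Summits.BirchSwinnertonDyer.BirchSwinnertonDyer.Theses.AdditiveKolyvaginRoad
import HarnessLib

/-!
# Route `AdditiveKolyvaginRoad`: the glue `PublishedInputsAdditiveKolyGlue` (item stmt-BirchSwinnertonDyer-20171), PROVED

Pure logic: `PublishedInputsAdditiveKoly` (the conjunction of the route's NAMED published inputs) is reassembled from its
five item-stated children (`RankEqAnalyticRankLeOne`, `EntireLFunctionRat`, `NewformOfEllipticCurve`,
`HoffsteinLuoNonvanishingTwist`, `McCallumShaStructureCertificate`) and the parametrised five
(`ParametrisedInputsAdditiveKoly`), in the order of the conjunction. No named fact, no `sorry`.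
(cell `pub/bsd-wall`, lead prover `bsd-wall-akr-p1` g2; `--workitem stmt-BirchSwinnertonDyer-20171`.)
[cite: GrossZagier1986, Thm. I.6.3] [cite: Kolyvagin1991, §1] [cite: McCallumLMS1991, §5 Cor. 5.6]
-/

-- single-conjunct summit: `Summit.BirchSwinnertonDyer.BirchSwinnertonDyer.…` repeats the name by design
set_option linter.dupNamespace false

namespace Summit.BirchSwinnertonDyer.BirchSwinnertonDyer.Theorems.AdditiveKoly

open Summit.BirchSwinnertonDyer.BirchSwinnertonDyer.Theses.AdditiveKolyvaginRoad

/-- **The glue item 20171**: the published-inputs conjunction from its item-stated conjuncts (pure logic, reordering).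
[cite: GrossZagier1986, Thm. I.6.3] [cite: Kolyvagin1991, §1] -/
theorem publishedInputsAdditiveKolyGlue : PublishedInputsAdditiveKolyGlue := by
  intro h1 h2 h3 h4 h5 hpar
  obtain ⟨hGZ, hKo, hK90, hconj, hphi⟩ := hpar
  exact ⟨hGZ, hKo, hK90, h1, h2, h3, h4, hconj, h5, hphi⟩

end Summit.BirchSwinnertonDyer.BirchSwinnertonDyer.Theorems.AdditiveKoly
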